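import Summits.BirchSwinnertonDyer.BirchSwinnertonDyer.Theorems.AlignedTransportAtTwoMainConjectureOfRankZeroBSDAtTwoFineRoadPerfectDescentSurj
import Literature.NumberTheory.EllipticCurves.KatoFineSelmerDualRelaxedAtInfinity
import Literature.NumberTheory.EllipticCurves.FineSelmerCoefficientMapProofs
import Literature.NumberTheory.EllipticCurves.H1TrivialAction
import HarnessLib

/-!
# Upstairs the action is trivial: `Sel₀^{rel ∞}(K_∞(E[2]), E[2])` and its `Gal(K̄/K_∞)`-invariants as explicit conditions on
# continuous HOMOMORPHISMS `Gal(K̄/K_∞(E[2])) → E[2]` (perfect descent, the lead's `Hom_{G_∞}(X⁺_{Σ-cs}(F_∞), E[2])` short of CFT)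

Cell `bsd-f1-sign2`, WIDTH-5 attach seat `bsd-line-att-p5` (gen 5) on line `birth` of crux C2
stmt-BirchSwinnertonDyer-22298 `MainConjectureOfRankZeroBSDAtTwo`; companion of `…FineRoadRelaxedPerfectDescent` (att-p5 g5:
`Sel₀^{rel ∞}(K_∞, E[2])` finite ⟺ the `Gal(K̄/K_∞)`-invariant part of `Sel₀^{rel ∞}(K_∞(E[2]), E[2])` is finite). A
`--supports 22298 --as helper` file. HONEST FRAMING: THEOREMS ONLY — no definition, no named fact, no `sorry`; BSD is NOT proved by
any of this.

WHAT. `H′ = ker κ ⊓ ker ρ̄_{E,2} = Gal(K̄/F_∞)`, `F_∞ = K_∞(E[2])`, acts TRIVIALLY on `E[2]` (`smul_eq_self_divisionFieldTower`), so by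
the tree's `H1TrivialAction` (Clark–Sharif §3.5 / Serre I §2.3: one cocycle per class) a class `x ∈ H¹(H′, E[2])` IS a continuous
homomorphism `f_x = evalH1 · x : H′ → E[2]` (`eq_of_forall_evalH1_eq`: `x` is determined by `f_x`). In these terms:
* **`resOfLe_conjH1_eq_zero_iff_forall_evalH1`**: the `(v, σ)` local condition `res_{H′ ⊓ D} (conj_σ x) = 0` ⟺ `f_x` kills
  `σ⁻¹ (H′ ∩ D) σ` (the decomposition group of `F_∞` at the conjugate place);
* **`mem_relaxedFine_upstairs_iff_forall_evalH1`**: `x ∈ Sel₀^{rel ∞}(H′; E[2])` ⟺ `f_x` kills the decomposition group (in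
  `Gal(K̄/F_∞)`) of EVERY place of `F_∞` above every finite place of `K` — `f_x` factors through the Galois group of the maximal
  abelian pro-`2` extension of `F_∞` split completely at all finite places (`X⁺_{cs}(F_∞)` after class field theory; no archimedean
  condition);
* **`conjH1_eq_self_iff_forall_evalH1`**: `conj_g x = x` ⟺ `g • f_x(g⁻¹ n g) = f_x(n)` for all `n` — `G_∞`-EQUIVARIANCE.
Hence (with `…RelaxedPerfectDescent` and `…RelaxedCoefficients`) statement (A)₂^{rel ∞}(E/ℚ) is the finiteness of the set of
continuous `G_∞`-equivariant homomorphisms `Gal(ℚ̄/F_∞) → E[2]` killing all decomposition groups at finite places: PERFECT-DESCENT.md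
§3 (ii) verbatim, short of the identification `Hom_cont(Gal(ℚ̄/F_∞)^{ab, cs}, E[2]) = Hom(X⁺_{Σ-cs}(F_∞), E[2])` (class field theory).

References: J.-P. Serre, *Galois Cohomology* I §2.3 (`H¹` of a trivial module `= Hom`), §2.5; P. L. Clark, S. Sharif, Algebra &
Number Theory 4 (2010) §3.5; R. Greenberg, Adv. Stud. Pure Math. 17 (1989) p. 98; the lead's PERFECT-DESCENT.md §3 (ii)–(iii).
-/

set_option autoImplicit false
-- the Theorems namespace of this sub repeats the summit name by design (D-0017 nested layout)
set_option linter.dupNamespace false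

noncomputable section

open scoped Classical

namespace Summit.BirchSwinnertonDyer.BirchSwinnertonDyer.Theorems.AlignedTransportAtTwoFineRoad.RelaxedPerfectDescentHom

open WeierstrassCurve NumberField IsDedekindDomain Field Literature.NumberTheory.EllipticCurves
  Literature.NumberTheory.EllipticCurves.GreenbergSelmer Literature.NumberTheory.GaloisRepresentations
  Literature.NumberTheory.EllipticCurves.FineSelmerCoefficientMap

/-! ## Classes of `H¹(Gal(K̄/K_∞(E[2])), E[2])` as continuous homomorphisms; the local conditions and the invariance on them -/

section ExplicitHom

variable {K : Type} [Field K] (W : WeierstrassCurve K) {p : ℕ} [Fact p.Prime] (κ : ZpExtension K p)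

/-- `Gal(K̄/K_∞(E[2])) = ker κ ⊓ ker ρ̄_{E,2}` acts TRIVIALLY on `E[2]`. [folklore] -/
theorem smul_eq_self_divisionFieldTower (n : ↥(κ.kerSubgroup ⊓ (W.galoisRepTorsion 2).ker))
    (m : ↥(W.geomTorsion 2)) : n • m = m :=
  PerfectDescent.smul_eq_self_of_mem_ker_galoisRepTorsion_two W n.2.2 m

/-- **The local condition upstairs, explicitly.** For a class `x ∈ H¹(H′, E[2])`, `H′ = ker κ ⊓ ker ρ̄_{E,2} = Gal(K̄/F_∞)`
(trivial action, so `x` IS a continuous homomorphism `f_x : H′ → E[2]`, `evalH1`), a subgroup `D ≤ Γ_K` and `σ ∈ Γ_K`: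
`res_{H′ ⊓ D} (conj_σ x) = 0` iff `f_x` kills `σ⁻¹ (H′ ∩ D) σ = H′ ∩ σ⁻¹ D σ` — with `D = D_v` this is «`f_x` vanishes on the
decomposition group of `F_∞` at the place `σ⁻¹ w_v`». [cite: SerreGaloisCohomology1997, I §2.3 (H¹ of a trivial module) and §2.5] -/
theorem resOfLe_conjH1_eq_zero_iff_forall_evalH1 (D : Subgroup (absoluteGaloisGroup K)) (σ : absoluteGaloisGroup K)
    (x : subgroupH1 (κ.kerSubgroup ⊓ (W.galoisRepTorsion 2).ker) (W.geomTorsion 2)) :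
    resOfLe (↥(W.geomTorsion 2))
        (inf_le_left : (κ.kerSubgroup ⊓ (W.galoisRepTorsion 2).ker) ⊓ D ≤ κ.kerSubgroup ⊓ (W.galoisRepTorsion 2).ker)
        (conjH1 (κ.kerSubgroup ⊓ (W.galoisRepTorsion 2).ker) (↥(W.geomTorsion 2)) σ x) = 0 ↔
      ∀ n : ↥(κ.kerSubgroup ⊓ (W.galoisRepTorsion 2).ker), (n : absoluteGaloisGroup K) ∈ D →
        evalH1 (smul_eq_self_divisionFieldTower W κ)
          ⟨σ⁻¹ * n * σ, conj_mem_of_normal _ σ n⟩ x = 0 := by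
  have htriv := smul_eq_self_divisionFieldTower W κ
  obtain ⟨f, rfl⟩ := oneCocycleClass_surjective _ x
  rw [conjH1_oneCocycleClass, Literature.NumberTheory.EllipticCurves.resOfLe, resH1Hom_oneCocycleClass,
    oneCocycleClass_eq_zero_iff]
  constructor
  · rintro ⟨t, ht⟩ n hn
    rw [evalH1_oneCocycleClass]
    have h := ht ⟨(n : absoluteGaloisGroup K), Subgroup.mem_inf.mpr ⟨n.2, hn⟩⟩
    rw [pullback_resHomOfEquivariant_apply, AddMonoidHom.id_apply, conjCocycle_apply, discreteTopRep_ρ_apply] at h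
    -- the right-hand side `g • t - t` vanishes (trivial action), and `σ •` is injective
    have hgt : (⟨(n : absoluteGaloisGroup K), Subgroup.mem_inf.mpr ⟨n.2, hn⟩⟩ :
        ↥((κ.kerSubgroup ⊓ (W.galoisRepTorsion 2).ker) ⊓ D)) • t - t = 0 := by
      rw [sub_eq_zero, Subgroup.smul_def]
      exact PerfectDescent.smul_eq_self_of_mem_ker_galoisRepTorsion_two W n.2.2 t
    rw [hgt, smul_eq_zero_iff_eq] at h
    have e : subgroupConj (κ.kerSubgroup ⊓ (W.galoisRepTorsion 2).ker) σ
        (subgroupInclusion (inf_le_left : (κ.kerSubgroup ⊓ (W.galoisRepTorsion 2).ker) ⊓ D ≤ _)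
          ⟨(n : absoluteGaloisGroup K), Subgroup.mem_inf.mpr ⟨n.2, hn⟩⟩) =
        ⟨σ⁻¹ * n * σ, conj_mem_of_normal _ σ n⟩ :=
      Subtype.ext (by rw [subgroupConj_apply_coe]; rfl)
    rw [e] at h
    exact h
  · intro h
    refine ⟨0, fun g ↦ ?_⟩
    rw [pullback_resHomOfEquivariant_apply, AddMonoidHom.id_apply, conjCocycle_apply, map_zero, sub_zero]
    have hg := Subgroup.mem_inf.mp g.2
    have e : subgroupConj (κ.kerSubgroup ⊓ (W.galoisRepTorsion 2).ker) σ
        (subgroupInclusion (inf_le_left : (κ.kerSubgroup ⊓ (W.galoisRepTorsion 2).ker) ⊓ D ≤ _) g) =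
        ⟨σ⁻¹ * ((⟨(g : absoluteGaloisGroup K), hg.1⟩ : ↥(κ.kerSubgroup ⊓ (W.galoisRepTorsion 2).ker)) :
          absoluteGaloisGroup K) * σ, conj_mem_of_normal _ σ ⟨(g : absoluteGaloisGroup K), hg.1⟩⟩ :=
      Subtype.ext (by rw [subgroupConj_apply_coe]; rfl)
    have h1 := h ⟨(g : absoluteGaloisGroup K), hg.1⟩ hg.2
    rw [evalH1_oneCocycleClass] at h1
    rw [e, h1, smul_zero]

/-- **The `Gal(K̄/K_∞)`-invariance upstairs, explicitly**: for `x ∈ H¹(H′, E[2])` with homomorphism `f_x` and `g ∈ Γ_K`,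
`conj_g x = x` iff `g • f_x(g⁻¹ n g) = f_x(n)` for all `n ∈ H′` (`G_∞`-EQUIVARIANCE of `f_x`). [cite: SerreGaloisCohomology1997, I §2.5] -/
theorem conjH1_eq_self_iff_forall_evalH1 (g : absoluteGaloisGroup K)
    (x : subgroupH1 (κ.kerSubgroup ⊓ (W.galoisRepTorsion 2).ker) (W.geomTorsion 2)) :
    conjH1 (κ.kerSubgroup ⊓ (W.galoisRepTorsion 2).ker) (↥(W.geomTorsion 2)) g x = x ↔
      ∀ n : ↥(κ.kerSubgroup ⊓ (W.galoisRepTorsion 2).ker),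
        g • evalH1 (smul_eq_self_divisionFieldTower W κ) ⟨g⁻¹ * n * g, conj_mem_of_normal _ g n⟩ x =
          evalH1 (smul_eq_self_divisionFieldTower W κ) n x := by
  have htriv := smul_eq_self_divisionFieldTower W κ
  obtain ⟨f, rfl⟩ := oneCocycleClass_surjective _ x
  rw [conjH1_oneCocycleClass, oneCocycleClass_eq_iff_of_trivial htriv]
  simp only [evalH1_oneCocycleClass]
  have e : ∀ n : ↥(κ.kerSubgroup ⊓ (W.galoisRepTorsion 2).ker),
      subgroupConj (κ.kerSubgroup ⊓ (W.galoisRepTorsion 2).ker) g n = ⟨g⁻¹ * n * g, conj_mem_of_normal _ g n⟩ :=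
    fun n ↦ Subtype.ext (by rw [subgroupConj_apply_coe])
  constructor
  · intro h n
    have h1 : (conjCocycle (κ.kerSubgroup ⊓ (W.galoisRepTorsion 2).ker) g f).1 n = f.1 n :=
      congrArg (fun c : contOneCocycles (discreteTopRep _ _) ↦ c.1 n) h
    rw [conjCocycle_apply, e n] at h1
    exact h1
  · intro h
    apply Subtype.ext
    refine ContinuousMap.ext fun n ↦ ?_
    rw [conjCocycle_apply, e n]
    exact h n

/-- **Two classes upstairs with the same homomorphism are equal** (`evalH1` is jointly injective: one cocycle per class for a
trivial action, `ext_of_trivial`). [cite: SerreGaloisCohomology1997, I §2.3] -/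
theorem eq_of_forall_evalH1_eq {x y : subgroupH1 (κ.kerSubgroup ⊓ (W.galoisRepTorsion 2).ker) (W.geomTorsion 2)}
    (h : ∀ n, evalH1 (smul_eq_self_divisionFieldTower W κ) n x = evalH1 (smul_eq_self_divisionFieldTower W κ) n y) :
    x = y := by
  have htriv := smul_eq_self_divisionFieldTower W κ
  rw [← oneCocycleClass_cocycleOf htriv x, ← oneCocycleClass_cocycleOf htriv y]
  congr 1
  apply Subtype.ext
  refine ContinuousMap.ext fun n ↦ ?_
  have hx := evalH1_oneCocycleClass htriv n (cocycleOf _ _ htriv x)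
  have hy := evalH1_oneCocycleClass htriv n (cocycleOf _ _ htriv y)
  rw [oneCocycleClass_cocycleOf] at hx hy
  rw [← hx, ← hy]
  exact h n

/-- **Membership in `Sel₀^{rel ∞}(F_∞; E[2])` upstairs, explicitly**: a class `x ∈ H¹(Gal(K̄/F_∞), E[2])`, `F_∞ = K_∞(E[2])`, lies
in Greenberg's relaxed-at-`∞` fine Selmer group iff its homomorphism `f_x` kills `σ⁻¹ (H′ ∩ D_v) σ` for every finite place `v` of
`K` and every `σ ∈ Γ_K`, i.e. kills the decomposition group (in `Gal(K̄/F_∞)`) of EVERY place of `F_∞` above every finite `v`: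
`f_x` factors through the Galois group of the maximal abelian pro-`2` extension of `F_∞` split completely at all finite places.
[cite: Greenberg1989, §1 p. 98] [cite: SerreGaloisCohomology1997, I §2.3] -/
theorem mem_relaxedFine_upstairs_iff_forall_evalH1 [NumberField K] (q : ℕ)
    (x : subgroupH1 (κ.kerSubgroup ⊓ (W.galoisRepTorsion 2).ker) (W.geomTorsion 2)) :
    x ∈ strictSelmerGroupOverRelaxedInf (κ.kerSubgroup ⊓ (W.galoisRepTorsion 2).ker) (↥(W.geomTorsion 2)) q
        (fineData (↥(W.geomTorsion 2)) q) ↔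
      ∀ (v : HeightOneSpectrum (𝓞 K)) (σ : absoluteGaloisGroup K)
        (n : ↥(κ.kerSubgroup ⊓ (W.galoisRepTorsion 2).ker)), (n : absoluteGaloisGroup K) ∈ decomp v →
        evalH1 (smul_eq_self_divisionFieldTower W κ) ⟨σ⁻¹ * n * σ, conj_mem_of_normal _ σ n⟩ x = 0 := by
  rw [mem_strictSelmerGroupOverRelaxedInf_iff]
  constructor
  · rintro ⟨h1, h3⟩ v σ
    rw [← resOfLe_conjH1_eq_zero_iff_forall_evalH1 W κ (decomp v) σ x]
    by_cases hv : ((q : ℕ) : 𝓞 K) ∈ v.asIdeal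
    · exact (mem_strictKer_fineLocalDatum_iff _ v _).1 (h3 v hv σ)
    · exact h1 v hv σ
  · intro h
    refine ⟨fun v _ σ ↦ ?_, fun v _ σ ↦ (mem_strictKer_fineLocalDatum_iff _ v _).2 ?_⟩
    · exact (resOfLe_conjH1_eq_zero_iff_forall_evalH1 W κ (decomp v) σ x).2 (h v σ)
    · exact (resOfLe_conjH1_eq_zero_iff_forall_evalH1 W κ (decomp v) σ x).2 (h v σ)

end ExplicitHom

end Summit.BirchSwinnertonDyer.BirchSwinnertonDyer.Theorems.AlignedTransportAtTwoFineRoad.RelaxedPerfectDescentHom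

end
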